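import Literature.Computability.FineGrained.LCSFromOVRun
import Literature.Computability.FineGrained.OVFromSETHDischarge
import Literature.Computability.FineGrained.EditDistanceSETH
import Literature.Computability.FineGrained.SubcubicEquivalencesAPSP
import Literature.Computability.Cryptography.FGComplexityProofs
import HarnessLib

/-!
# OV → LCS on the word RAM, V: the fine-grained reduction and SETH-hardness of binary LCS

The assembly of Bringmann–Künnemann's SETH lower bound for the longest common subsequence of two
**binary** strings (K. Bringmann, M. Künnemann, *Quadratic conditional lower bounds for string
problems and dynamic time warping*, FOCS 2015, Thm. 1.2 for LCS, via Thm. 3.3 + Lemma 4.1–4.3;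
independently for alphabet size 7: Abboud–Backurs–Vassilevska Williams, FOCS 2015, Thm. 1) in the
deterministic word-RAM model of this library:

* `LCSRed.Geo.BND_le`: every constant of the reduction program is `O((n+1)(d+1))`, so a word size
  of `40 ·` input width holds them (`LCSRed.BND_lt_two_pow`);
* `OVArea`: OV with the size measure `(n+1)(d+1)` (same instances, encoding and answers as `OV`);
  `OVArea_isStandard`, `LCS_isStandard`, `OVArea_sizeFitsWord`;
* **`OVArea_fgReducible_LCS`**: `(OVArea, s²) ≤_FG (LCS, m²)` by the verified program `LCSRed.M`
  (one LCS query of total length `O((n+1)(d+1))`, `O((n+1)(d+1))` time);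
* **`not_lcs_inTimeO_of_ovhWordRAM`**: OVH (word RAM) ⇒ binary LCS has no `O(m^{2-ε})` algorithm,
  through the proved transfer property `FGReducible.trulySubTime_of_sizeFitsWord_holds`;
* **`not_lcs_inTimeO_of_sethWordRAM_holds`**: the discharge of the named fact
  `not_lcs_inTimeO_of_sethWordRAM` of `Literature.Computability.FineGrained.SETHHardness`, from
  `ovConjectureDet_of_sethWordRAM_holds` (Williams' split-and-list, proved in
  `OVFromSETHDischarge`) and the above. (It cannot live in `SETHHardnessProofs`, which is upstream
  of `OVFromSETHDischarge`.)
-/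

namespace Literature.Computability.FineGrained

open Cryptography Cryptography.WordRAM Cryptography.WordRAM.SProg FGProblem BKGadget BKLCS
  BKLCSReduction LCSRed

/-! ### The constants of the program are `O((n+1)(d+1))` -/

namespace LCSRed.Geo

variable (g : Geo)

/-- Level-2 and level-3 gadget parameters are `O(d + 1)`. [folklore] -/
theorem params_le :
    g.q₂.ℓx ≤ 246 * (g.d + 1) ∧ g.q₂.ℓy ≤ 506 * (g.d + 1) ∧ g.q₂.sx ≤ 123 * (g.d + 1) ∧
    g.q₂.γ₁ ≤ 752 * (g.d + 1) ∧ g.q₂.γ₂ ≤ 4512 * (g.d + 1) ∧ g.q₂.γ₃ ≤ 7766 * (g.d + 1) ∧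
    g.q₂.γ₄ ≤ 9776 * (g.d + 1) ∧
    g.q₃.ℓx ≤ 29314 * (g.d + 1) ∧ g.q₃.ℓy ≤ 50138 * (g.d + 1) ∧ g.q₃.sx ≤ 18294 * (g.d + 1) ∧
    g.q₃.γ₁ ≤ 79452 * (g.d + 1) ∧ g.q₃.γ₂ ≤ 476712 * (g.d + 1) ∧ g.q₃.γ₃ ≤ 831108 * (g.d + 1) ∧
    g.q₃.γ₄ ≤ 1032876 * (g.d + 1) := by
  have h1 := g.q₂_ℓx; have h2 := g.q₂_ℓy; have h3 := g.q₂_sx; have h4 := g.q₂_γ₁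
  have h5 := g.q₂_γ₂; have h6 := g.q₂_γ₃; have h7 := g.q₂_γ₄
  have h8 := g.q₃_ℓx; have h9 := g.q₃_ℓy; have h10 := g.q₃_sx; have h11 := g.q₃_γ₁
  have h12 := g.q₃_γ₂; have h13 := g.q₃_γ₃; have h14 := g.q₃_γ₄
  omega

/-- `n p ≤ c (n+1)(d+1)` for `p ≤ c (d+1)`. [folklore] -/
theorem mul_le_area {p c m : ℕ} (hp : p ≤ c * (g.d + 1)) (hm : m ≤ g.n + 1) :
    m * p ≤ c * ((g.n + 1) * (g.d + 1)) :=
  calc m * p ≤ (g.n + 1) * (c * (g.d + 1)) := Nat.mul_le_mul hm hp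
    _ = c * ((g.n + 1) * (g.d + 1)) := by ring

/-- **Every constant of the run is `O((n+1)(d+1))`.** [folklore] -/
theorem BND_le (hD : g.D = 2 + 2 * (g.n * g.d) + 100) :
    g.BND ≤ 1000000000 * ((g.n + 1) * (g.d + 1)) := by
  obtain ⟨e1, e2, e3, e4, e5, e6, e7, e8, e9, e10, e11, e12, e13, e14⟩ := g.params_le
  have hnd : g.n * g.d ≤ (g.n + 1) * (g.d + 1) := Nat.mul_le_mul (by omega) (by omega)
  have hd1 : g.d + 1 ≤ (g.n + 1) * (g.d + 1) := Nat.le_mul_of_pos_left _ (by omega)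
  have hn1 : g.n ≤ (g.n + 1) * (g.d + 1) := by nlinarith
  have hG₃ : g.G₃ ≤ 1141642 * (g.d + 1) := by unfold Geo.G₃; omega
  have hG₃y : g.G₃y ≤ 1162466 * (g.d + 1) := by unfold Geo.G₃y; omega
  have hρ₁ : g.rho₁ ≤ 39370 * (g.d + 1) := by unfold Geo.rho₁ Geo.C₂ Geo.C₁; omega
  have hρ₀ : g.rho₀ ≤ 39370 * (g.d + 1) := by unfold Geo.rho₀ Geo.C₂ Geo.C₁; omega
  have hLX : g.LX ≤ 3945500 * ((g.n + 1) * (g.d + 1)) := by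
    unfold Geo.LX
    have a := g.mul_le_area hG₃ (le_refl (g.n + 1))
    have b := g.mul_le_area e13 (le_refl (g.n + 1))
    have : (g.n + g.n) * g.G₃ ≤ 2 * ((g.n + 1) * g.G₃) := by nlinarith
    have : (g.n + g.n - 1) * g.q₃.γ₃ ≤ 2 * ((g.n + 1) * g.q₃.γ₃) := by
      have : g.n + g.n - 1 ≤ 2 * (g.n + 1) := by omega
      calc (g.n + g.n - 1) * g.q₃.γ₃ ≤ (2 * (g.n + 1)) * g.q₃.γ₃ := Nat.mul_le_mul_right _ this
        _ = _ := by ring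
    omega
  have hLC : g.LC ≤ 1993574 * ((g.n + 1) * (g.d + 1)) := by
    unfold Geo.LC
    have a := g.mul_le_area hG₃y (Nat.le_succ g.n)
    have b := g.mul_le_area e13 (show g.n - 1 ≤ g.n + 1 by omega)
    omega
  have hNP : g.NP ≤ 2065752 * ((g.n + 1) * (g.d + 1)) := by
    unfold Geo.NP
    have a := g.mul_le_area e14 (Nat.le_succ g.n)
    omega
  have hLY : g.LY ≤ 6125078 * ((g.n + 1) * (g.d + 1)) := by unfold Geo.LY; omega
  have hLEN : g.LEN ≤ 10070579 * ((g.n + 1) * (g.d + 1)) := by unfold Geo.LEN; omega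
  have hρ : g.rho ≤ 4210244 * ((g.n + 1) * (g.d + 1)) := by
    unfold Geo.rho
    have a := g.mul_le_area hρ₁ (show g.n - 1 ≤ g.n + 1 by omega)
    omega
  have hQ : g.Q ≤ 205 * ((g.n + 1) * (g.d + 1)) := by unfold Geo.Q Geo.L; omega
  unfold Geo.BND
  omega

end LCSRed.Geo

namespace LCSRed

/-- **The word size `40 · width` holds every constant of the run.** [folklore] -/
theorem BND_lt_two_pow (I : OVInstance) : (geo I).BND < 2 ^ (40 * inputWidth (OV.encode I)) := by
  have hB := (geo I).BND_le (geo_D I)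
  rw [(geo_nd I).1, (geo_nd I).2] at hB
  set w := inputWidth (OV.encode I) with hw
  have hw1 : 1 ≤ w := inputWidth_pos _
  have hn : I.n < 2 ^ w := lt_two_pow_inputWidth_of_mem _ _ (by rw [OV_encode_eq]; simp)
  have hd : I.d < 2 ^ w := lt_two_pow_inputWidth_of_mem _ _ (by rw [OV_encode_eq]; simp)
  have hT : (I.n + 1) * (I.d + 1) ≤ 2 ^ w * 2 ^ w := Nat.mul_le_mul hn hd
  have h30 : (1000000000 : ℕ) < 2 ^ 30 := by norm_num
  have h1 : 2 ^ 30 * (2 ^ w * 2 ^ w) ≤ 2 ^ (40 * w) := by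
    rw [← pow_add, ← pow_add]
    exact Nat.pow_le_pow_right (by norm_num) (by omega)
  have hpos : 0 < 2 ^ w * 2 ^ w := by positivity
  calc (geo I).BND ≤ 1000000000 * ((I.n + 1) * (I.d + 1)) := hB
    _ < 2 ^ 30 * (2 ^ w * 2 ^ w) := by
        calc 1000000000 * ((I.n + 1) * (I.d + 1)) ≤ 1000000000 * (2 ^ w * 2 ^ w) :=
              Nat.mul_le_mul_left _ hT
          _ < 2 ^ 30 * (2 ^ w * 2 ^ w) := Nat.mul_lt_mul_of_pos_right h30 hpos
    _ ≤ 2 ^ (40 * w) := h1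

end LCSRed

/-! ### Real-analysis bookkeeping for the budgets `s ↦ s²` -/

namespace LCSRed

/-- `(s²)^{1/2} = s`. [folklore] -/
theorem rpow_two_rpow_half {s : ℝ} (hs : 0 ≤ s) : (s ^ (2 : ℝ)) ^ (1 - 1 / 2 : ℝ) = s := by
  rw [← Real.rpow_mul hs]; norm_num

/-- `s ≤ (s²)^{1-δ}` for `s ≥ 1`, `δ ≤ 1/2`. [folklore] -/
theorem self_le_budget {s δ : ℝ} (hs : 1 ≤ s) (hδ : δ ≤ 1 / 2) : s ≤ (s ^ (2 : ℝ)) ^ (1 - δ) := by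
  rw [← Real.rpow_mul (by linarith)]
  calc s = s ^ (1 : ℝ) := (Real.rpow_one s).symm
    _ ≤ s ^ (2 * (1 - δ)) := Real.rpow_le_rpow_of_exponent_le hs (by linarith)

/-- The budget is at least `1` for `s ≥ 1`. [folklore] -/
theorem one_le_budget {s δ : ℝ} (hs : 1 ≤ s) (hδ : δ ≤ 1 / 2) : 1 ≤ (s ^ (2 : ℝ)) ^ (1 - δ) :=
  hs.trans (self_le_budget hs hδ)

/-- The ledger of one query of size `m ≤ K s`: `(m²)^{1-ε'} ≤ K² (s²)^{1-δ}` for `δ ≤ ε' ≤ 1`,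
`s, K ≥ 1`. [folklore] -/
theorem ledger_le {m s K ε' δ : ℝ} (hm0 : 0 ≤ m) (hm : m ≤ K * s) (hs : 1 ≤ s) (hK : 1 ≤ K)
    (hε' : ε' ≤ 1) (hδε : δ ≤ ε') (hδ0 : 0 ≤ δ) :
    (m ^ (2 : ℝ)) ^ (1 - ε') ≤ K ^ (2 : ℕ) * (s ^ (2 : ℝ)) ^ (1 - δ) := by
  have hKs : 1 ≤ K * s := by nlinarith
  have hKs0 : 0 ≤ K * s := by linarith
  calc (m ^ (2 : ℝ)) ^ (1 - ε') ≤ ((K * s) ^ (2 : ℝ)) ^ (1 - ε') :=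
        Real.rpow_le_rpow (Real.rpow_nonneg hm0 _) (Real.rpow_le_rpow hm0 hm (by norm_num)) (by linarith)
    _ = (K * s) ^ (2 * (1 - ε')) := by rw [← Real.rpow_mul hKs0]
    _ ≤ (K * s) ^ (2 * (1 - δ)) := Real.rpow_le_rpow_of_exponent_le hKs (by linarith)
    _ = K ^ (2 * (1 - δ)) * s ^ (2 * (1 - δ)) := Real.mul_rpow (by linarith) (by linarith)
    _ ≤ K ^ (2 : ℝ) * s ^ (2 * (1 - δ)) := by
        refine mul_le_mul_of_nonneg_right ?_ (Real.rpow_nonneg (by linarith) _)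
        exact Real.rpow_le_rpow_of_exponent_le hK (by linarith)
    _ = K ^ (2 : ℕ) * (s ^ (2 : ℝ)) ^ (1 - δ) := by
        rw [← Real.rpow_mul (by linarith), Real.rpow_two]

end LCSRed

/-! ### OV with the area size measure, and well-formedness -/

/-- **OV with the size measure `(n+1)(d+1)`**: the same instances, encoding and accepted answers as
`OV` (so `OVArea.InTimeInst = OV.InTimeInst`), with the size in which Bringmann–Künnemann's
reduction is linear. [folklore] -/
noncomputable def OVArea : FGProblem :=
  FGProblem.ofPred OVInstance.encode (fun I => (I.n + 1) * (I.d + 1)) OVInstance.HasOrthogonalPair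

/-- The input width of an `OV` input is at most `3 (n+1)(d+1)`. [folklore] -/
theorem inputWidth_OV_encode_le (I : OVInstance) :
    inputWidth (OV.encode I) ≤ 3 * ((I.n + 1) * (I.d + 1)) := by
  unfold inputWidth
  refine (CliqueRed.size_le_self _).trans (max_le ?_ ?_)
  · rw [length_OV_encode]; nlinarith
  · refine foldr_max_one_le (by nlinarith) fun v hv => ?_
    refine (le_of_mem_OV_encode I hv).trans (max_le (by nlinarith) (max_le (by nlinarith) (by nlinarith)))

/-- **`OVArea` is well formed for the budget `s²`.** [folklore] -/
theorem OVArea_isStandard : OVArea.IsStandard fun s => (s : ℝ) ^ (2 : ℝ) where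
  nonneg s := Real.rpow_nonneg (Nat.cast_nonneg _) _
  length_le := ⟨2, 1 / 2, by norm_num, fun I => by
    change (((OV.encode I).length : ℕ) : ℝ) ≤
      2 * ((((I.n + 1) * (I.d + 1) : ℕ) : ℝ) ^ (2 : ℝ)) ^ (1 - 1 / 2 : ℝ) + 2
    rw [LCSRed.rpow_two_rpow_half (Nat.cast_nonneg _), length_OV_encode]
    push_cast
    nlinarith [I.n.cast_nonneg (α := ℝ), I.d.cast_nonneg (α := ℝ)]⟩
  width_le := ⟨3, fun I => by
    change ((inputWidth (OV.encode I) : ℕ) : ℝ) ≤ 3 * (((I.n + 1) * (I.d + 1) : ℕ) : ℝ) ^ (2 : ℝ) + 3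
    have h := inputWidth_OV_encode_le I
    have hT : (1 : ℝ) ≤ (((I.n + 1) * (I.d + 1) : ℕ) : ℝ) := by exact_mod_cast Nat.one_le_iff_ne_zero.2 (by positivity)
    have hT2 : (((I.n + 1) * (I.d + 1) : ℕ) : ℝ) ≤ (((I.n + 1) * (I.d + 1) : ℕ) : ℝ) ^ (2 : ℝ) := by
      rw [Real.rpow_two]; nlinarith
    have : ((inputWidth (OV.encode I) : ℕ) : ℝ) ≤ 3 * (((I.n + 1) * (I.d + 1) : ℕ) : ℝ) := by exact_mod_cast h
    linarith⟩
  hasWordOutputs := hasWordOutputs_ofPred _ _ _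

/-- **`OVArea`'s size fits in a word**: `(n+1)(d+1) < 2 ^ (3 · width)`. [folklore] -/
theorem OVArea_sizeFitsWord : OVArea.SizeFitsWord := by
  refine ⟨3, fun I => ?_⟩
  change (I.n + 1) * (I.d + 1) < 2 ^ (3 * inputWidth (OV.encode I))
  set w := inputWidth (OV.encode I)
  have hw1 : 1 ≤ w := inputWidth_pos _
  have hn : I.n < 2 ^ w := lt_two_pow_inputWidth_of_mem _ _ (by rw [OV_encode_eq]; simp)
  have hd : I.d < 2 ^ w := lt_two_pow_inputWidth_of_mem _ _ (by rw [OV_encode_eq]; simp)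
  calc (I.n + 1) * (I.d + 1) ≤ 2 ^ w * 2 ^ w := Nat.mul_le_mul hn hd
    _ < 2 ^ w * 2 ^ w * 2 ^ w := by
        have : 1 < 2 ^ w := Nat.one_lt_two_pow (by omega)
        have h0 : 0 < 2 ^ w * 2 ^ w := by positivity
        nlinarith
    _ = 2 ^ (3 * w) := by rw [← pow_add, ← pow_add]; congr 1; omega

/-- The length of an `LCS` input. [folklore] -/
theorem length_encodeBoolPair (p : List Bool × List Bool) :
    (encodeBoolPair p).length = p.1.length + p.2.length + 1 := by
  simp [encodeBoolPair]

/-- The words of an `LCS` input are the header `|s|` and bits. [folklore] -/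
theorem le_of_mem_encodeBoolPair (p : List Bool × List Bool) {v : ℕ} (hv : v ∈ encodeBoolPair p) :
    v ≤ p.1.length + p.2.length + 1 := by
  simp only [encodeBoolPair, List.mem_cons, List.mem_map, List.mem_append] at hv
  rcases hv with rfl | ⟨b, _, rfl⟩
  · omega
  · have := Bool.toNat_le b; omega

/-- **Binary `LCS` is well formed for the budget `m²`.** [folklore] -/
theorem LCS_isStandard : LCS.IsStandard fun m => (m : ℝ) ^ (2 : ℝ) where
  nonneg m := Real.rpow_nonneg (Nat.cast_nonneg _) _
  length_le := ⟨1, 1 / 2, by norm_num, fun p => by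
    change (((encodeBoolPair p).length : ℕ) : ℝ) ≤
      1 * ((((p.1.length + p.2.length) : ℕ) : ℝ) ^ (2 : ℝ)) ^ (1 - 1 / 2 : ℝ) + 1
    rw [LCSRed.rpow_two_rpow_half (Nat.cast_nonneg _), length_encodeBoolPair]
    push_cast; linarith⟩
  width_le := ⟨2, fun p => by
    change ((inputWidth (encodeBoolPair p) : ℕ) : ℝ) ≤ 2 * (((p.1.length + p.2.length) : ℕ) : ℝ) ^ (2 : ℝ) + 2
    have h : inputWidth (encodeBoolPair p) ≤ p.1.length + p.2.length + 1 := by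
      unfold inputWidth
      refine (CliqueRed.size_le_self _).trans (max_le (by rw [length_encodeBoolPair]) ?_)
      exact foldr_max_one_le (by omega) fun v hv => le_of_mem_encodeBoolPair p hv
    have h' : ((inputWidth (encodeBoolPair p) : ℕ) : ℝ) ≤ (((p.1.length + p.2.length) : ℕ) : ℝ) + 1 := by
      exact_mod_cast h
    have hsq : (((p.1.length + p.2.length) : ℕ) : ℝ) ≤ (((p.1.length + p.2.length) : ℕ) : ℝ) ^ (2 : ℝ) + 1 := by
      rw [Real.rpow_two]; nlinarith [(p.1.length + p.2.length).cast_nonneg (α := ℝ)]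
    have h0 : (0 : ℝ) ≤ (((p.1.length + p.2.length) : ℕ) : ℝ) ^ (2 : ℝ) := Real.rpow_nonneg (Nat.cast_nonneg _) _
    linarith⟩
  hasWordOutputs := by
    refine ⟨1, 1, fun p out hout => ?_⟩
    have hout' : out = [lcsLength p.1 p.2] := by simpa [LCS, FGProblem.ofFun] using hout
    subst hout'
    change [lcsLength p.1 p.2].length ≤ 1 * (encodeBoolPair p).length + 1 ∧
      ∀ v ∈ [lcsLength p.1 p.2], v < 2 ^ (1 * inputWidth (encodeBoolPair p))
    refine ⟨by simp, fun v hv => lt_two_pow_mul_inputWidth ?_⟩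
    simp only [List.mem_singleton] at hv
    subst hv
    rw [pow_one, length_encodeBoolPair]
    have := lcsLength_le_length_left p.1 p.2
    omega

/-! ### The fine-grained reduction -/

/-- The total time is `O((n+1)(d+1))`. [folklore] -/
theorem LCSRed.Ttot_le (I : OVInstance) : LCSRed.Ttot I + 1 ≤ 100000000000 * ((I.n + 1) * (I.d + 1)) := by
  have hB := (LCSRed.geo I).BND_le (LCSRed.geo_D I)
  rw [(LCSRed.geo_nd I).1, (LCSRed.geo_nd I).2] at hB
  have hnd : I.n * I.d ≤ (I.n + 1) * (I.d + 1) := Nat.mul_le_mul (by omega) (by omega)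
  unfold LCSRed.Ttot LCSRed.Geo.BND at *
  omega

/-- **`(OVArea, s²) ≤_FG (LCS, m²)`** (Bringmann–Künnemann, FOCS 2015, Thm. 3.3 with §4 for LCS,
on the word RAM): for every `ε > 0` the definition of `FGReducible` is met by the verified program
`LCSRed.M` with `δ = min ε (1/2)`, word size `40 · width`, `C = 10¹⁸`: one LCS query
`(x, y) = (ovX I, ovY I)` of total length `O((n+1)(d+1))`, answered `[L(x,y)]`, decides
`δ_LCS(x, y) ≤ ρ`, i.e. the existence of an orthogonal pair, in time `O((n+1)(d+1))`.
[cite: BringmannKunnemannFOCS2015, Thm. 3.3 and Thm. 1.2 (LCS)] -/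
theorem OVArea_fgReducible_LCS :
    FGReducible OVArea (fun s => (s : ℝ) ^ (2 : ℝ)) LCS (fun m => (m : ℝ) ^ (2 : ℝ)) := by
  intro ε hε
  refine ⟨min ε (1 / 2), lt_min hε (by norm_num), LCSRed.M, 40, 1000000000000000000,
    LCSRed.M_isDeterministic, ?_⟩
  intro O hO I
  classical
  set δ : ℝ := min ε (1 / 2) with hδ
  have hδε : δ ≤ ε := min_le_left _ _
  have hδ2 : δ ≤ 1 / 2 := min_le_right _ _
  have hδ0 : 0 ≤ δ := (lt_min hε (by norm_num)).le
  set w : ℕ := 40 * inputWidth (OV.encode I) with hw_def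
  have hw : inputWidth (OV.encode I) ≤ w := inputWidth_le_mul (by norm_num) _
  have hB : (LCSRed.geo I).BND < 2 ^ w := LCSRed.BND_lt_two_pow I
  obtain ⟨st, t, ht, hex, hout, hq⟩ := LCSRed.prog_exec (W := w) I hB hO
  rw [← init_mem_eq_initFun hw] at hex
  -- the budget
  set T : ℝ := (((I.n + 1) * (I.d + 1) : ℕ) : ℝ) with hT
  have hT1 : (1 : ℝ) ≤ T := by
    rw [hT]; exact_mod_cast Nat.one_le_iff_ne_zero.2 (by positivity)
  have hbud := LCSRed.self_le_budget hT1 hδ2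
  have hbud1 := LCSRed.one_le_budget hT1 hδ2
  have hBND := (LCSRed.geo I).BND_le (LCSRed.geo_D I)
  rw [(LCSRed.geo_nd I).1, (LCSRed.geo_nd I).2] at hBND
  have hBNDr : (((LCSRed.geo I).BND : ℕ) : ℝ) ≤ 1000000000 * T := by rw [hT]; exact_mod_cast hBND
  refine ⟨st.cfg none 0, if I.n = 0 then [] else [(ovX I, ovY I)], ?_, ?_, ?_, ?_, ?_⟩
  · -- the run halts within the budget
    refine haltsWithin_toProgram hex (Nat.le_floor ?_) zeroCoins
    change ((t + 1 : ℕ) : ℝ) ≤ (1000000000000000000 : ℝ) * (T ^ (2 : ℝ)) ^ (1 - δ) + (1000000000000000000 : ℝ)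
    have h1 := LCSRed.Ttot_le I
    have h2 : ((t + 1 : ℕ) : ℝ) ≤ 100000000000 * T := by
      rw [hT]; exact_mod_cast (Nat.succ_le_succ ht).trans h1
    linarith [h2, hbud, hbud1]
  · -- the output is the accepted one
    change readOut st.mem ∈ (FGProblem.ofPred OVInstance.encode (fun I => (I.n + 1) * (I.d + 1))
      OVInstance.HasOrthogonalPair).Good I
    rw [hout]
    by_cases h : I.HasOrthogonalPair
    · rw [if_pos h, FGProblem.ofPred_good_of_pos OVInstance.encode (fun I : OVInstance => (I.n + 1) * (I.d + 1))
        OVInstance.HasOrthogonalPair I h]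
      exact Set.mem_singleton _
    · rw [if_neg h, FGProblem.ofPred_good_of_neg OVInstance.encode (fun I : OVInstance => (I.n + 1) * (I.d + 1))
        OVInstance.HasOrthogonalPair I h]
      exact Set.mem_singleton _
  · -- the query log
    change st.queries = _
    rw [hq]
    by_cases h0 : I.n = 0
    · simp [h0]
    · simp [h0]; rfl
  · -- the ledger
    by_cases h0 : I.n = 0
    · simp only [h0, if_true, List.map_nil, List.sum_nil]
      positivity
    · have hn : 0 < I.n := Nat.pos_of_ne_zero h0
      simp only [h0, if_false, List.map_cons, List.map_nil, List.sum_cons, List.sum_nil, add_zero]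
      change ((((ovX I).length + (ovY I).length : ℕ) : ℝ) ^ (2 : ℝ)) ^ (1 - ε) ≤
        (1000000000000000000 : ℝ) * (T ^ (2 : ℝ)) ^ (1 - δ) + (1000000000000000000 : ℝ)
      have hm : (ovX I).length + (ovY I).length ≤ (LCSRed.geo I).BND := by
        rw [LCSRed.length_ovX_eq (LCSRed.geo I) I (LCSRed.geo_nd I) hn,
          LCSRed.length_ovY_eq (LCSRed.geo I) I (LCSRed.geo_nd I)]
        unfold LCSRed.Geo.BND; omega
      have hm1 : 1 ≤ (ovX I).length + (ovY I).length := by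
        rw [LCSRed.length_ovX_eq (LCSRed.geo I) I (LCSRed.geo_nd I) hn]
        unfold LCSRed.Geo.LX LCSRed.Geo.G₃
        rw [(LCSRed.geo_nd I).1]
        have h1 : 1 ≤ (LCSRed.geo I).q₃.ℓx := by
          rw [(LCSRed.geo I).q₃_ℓx, (LCSRed.geo I).q₂_ℓx]; omega
        have h2 : 1 * 1 ≤ (I.n + I.n) * ((LCSRed.geo I).q₃.γ₂ + (LCSRed.geo I).q₃.γ₁ +
            (LCSRed.geo I).q₃.ℓx + (LCSRed.geo I).q₃.γ₁ + (LCSRed.geo I).q₃.γ₂) :=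
          Nat.mul_le_mul (by omega) (by omega)
        omega
      set m : ℝ := (((ovX I).length + (ovY I).length : ℕ) : ℝ) with hm_def
      have hm0 : (0 : ℝ) ≤ m := Nat.cast_nonneg _
      have hmr : m ≤ 1000000000 * T := le_trans (by rw [hm_def]; exact_mod_cast hm) hBNDr
      have hm1r : (1 : ℝ) ≤ m := by rw [hm_def]; exact_mod_cast hm1
      -- shrink `ε` to `ε' = min ε 1`
      have hstep : (m ^ (2 : ℝ)) ^ (1 - ε) ≤ (m ^ (2 : ℝ)) ^ (1 - min ε 1) := by
        refine Real.rpow_le_rpow_of_exponent_le ?_ (by linarith [min_le_left ε 1])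
        rw [Real.rpow_two]; exact one_le_pow₀ hm1r
      have hled := LCSRed.ledger_le (ε' := min ε 1) (δ := δ) hm0 hmr hT1 (by norm_num) (min_le_right _ _)
        (le_min hδε (hδ2.trans (by norm_num))) hδ0
      have h18 : (1000000000 : ℝ) ^ (2 : ℕ) * (T ^ (2 : ℝ)) ^ (1 - δ) =
          1000000000000000000 * (T ^ (2 : ℝ)) ^ (1 - δ) := by norm_num
      rw [h18] at hled
      linarith
  · -- the total query length
    by_cases h0 : I.n = 0
    · simp only [h0, if_true, List.map_nil, List.sum_nil, Nat.cast_zero]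
      positivity
    · have hn : 0 < I.n := Nat.pos_of_ne_zero h0
      simp only [h0, if_false, List.map_cons, List.map_nil, List.sum_cons, List.sum_nil, add_zero]
      change (((encodeBoolPair (ovX I, ovY I)).length : ℕ) : ℝ) ≤
        (1000000000000000000 : ℝ) * (T ^ (2 : ℝ)) ^ (1 - δ) + (1000000000000000000 : ℝ)
      rw [length_encodeBoolPair]
      have hm : (ovX I).length + (ovY I).length ≤ (LCSRed.geo I).BND := by
        rw [LCSRed.length_ovX_eq (LCSRed.geo I) I (LCSRed.geo_nd I) hn,
          LCSRed.length_ovY_eq (LCSRed.geo I) I (LCSRed.geo_nd I)]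
        unfold LCSRed.Geo.BND; omega
      have hmr : ((((ovX I, ovY I).1.length + (ovX I, ovY I).2.length + 1 : ℕ)) : ℝ) ≤ 1000000000 * T + 1 := by
        have : ((((ovX I).length + (ovY I).length : ℕ)) : ℝ) ≤ 1000000000 * T :=
          le_trans (by exact_mod_cast hm) hBNDr
        push_cast at this ⊢; linarith
      linarith [hmr, hbud, hbud1]

/-! ### OVH ⇒ no subquadratic binary LCS; SETH ⇒ the same -/

/-- `OVArea` and `OV` have the same algorithms. [folklore] -/
theorem OVArea_inTimeInst_iff (T : OVInstance → ℕ) : OVArea.InTimeInst T ↔ OV.InTimeInst T := Iff.rfl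

/-- **OVH (word RAM) ⇒ binary LCS has no `O(m^{2-ε})` algorithm** (Bringmann–Künnemann, FOCS 2015,
Thm. 1.2 for LCS, from OVH): an `O(m^{2-ε})` LCS algorithm makes `LCS` truly subquadratic, hence —
by `OVArea_fgReducible_LCS` and the proved transfer property — `OVArea` truly sub-`s²`, i.e. OV in
time `O(((n+1)(d+1))^{2-ε'}) ≤ O((n+1)^{2-ε'} (d+1)²)`, contradicting OVH.
[cite: BringmannKunnemannFOCS2015, Thm. 1.2 (LCS)] -/
theorem not_lcs_inTimeO_of_ovhWordRAM (hOVH : OVHWordRAM) (ε : ℝ) (hε : 0 < ε) :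
    ¬ LCS.InTimeO fun n => (n : ℝ) ^ (2 - ε) := by
  intro hLCS
  have hsub : LCS.TrulySubTime 2 := ⟨ε, hε, hLCS⟩
  obtain ⟨ε', hε', C, hC⟩ := FGReducible.trulySubTime_of_sizeFitsWord_holds OVArea_fgReducible_LCS hsub
    OVArea_isStandard LCS_isStandard OVArea_sizeFitsWord
  -- shrink the saving to `ε'' = min ε' 1`, so that the exponent `2 - ε''` lies in `[1, 2]`
  set ε'' : ℝ := min ε' 1 with hε''
  have hε''pos : 0 < ε'' := lt_min hε' one_pos
  refine hOVH ε'' hε''pos ⟨2 * max C 1, 2, ?_⟩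
  rw [← OVArea_inTimeInst_iff]
  refine InTimeInst.mono (P := OVArea) hC fun I => Nat.floor_le_floor ?_
  change C * ((((I.n + 1) * (I.d + 1) : ℕ) : ℝ)) ^ (2 - ε') + C ≤
    2 * max C 1 * (((I.n : ℝ) + 1) ^ (2 - ε'') * ((I.d : ℝ) + 1) ^ (2 : ℕ))
  set M : ℝ := max C 1 with hM
  have hC1 : C ≤ M := le_max_left _ _
  have hM1 : (1 : ℝ) ≤ M := le_max_right _ _
  have hn1 : (1 : ℝ) ≤ (I.n : ℝ) + 1 := by linarith [I.n.cast_nonneg (α := ℝ)]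
  have hd1 : (1 : ℝ) ≤ (I.d : ℝ) + 1 := by linarith [I.d.cast_nonneg (α := ℝ)]
  have he1 : 2 - ε' ≤ 2 - ε'' := by linarith [min_le_left ε' 1]
  have hε''1 : ε'' ≤ 1 := min_le_right _ _
  have he2 : 2 - ε'' ≤ 2 := by linarith
  have hT : ((((I.n + 1) * (I.d + 1) : ℕ) : ℝ)) = ((I.n : ℝ) + 1) * ((I.d : ℝ) + 1) := by push_cast; ring
  have hT1 : (1 : ℝ) ≤ ((I.n : ℝ) + 1) * ((I.d : ℝ) + 1) := by nlinarith
  rw [hT]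
  set A : ℝ := ((I.n : ℝ) + 1) ^ (2 - ε'') * ((I.d : ℝ) + 1) ^ (2 : ℕ) with hA
  have hpow0 : (0 : ℝ) ≤ (((I.n : ℝ) + 1) * ((I.d : ℝ) + 1)) ^ (2 - ε') := Real.rpow_nonneg (by linarith) _
  -- `T^{2-ε'} ≤ T^{2-ε''} = (n+1)^{2-ε''} (d+1)^{2-ε''} ≤ (n+1)^{2-ε''} (d+1)² = A`
  have h1 : (((I.n : ℝ) + 1) * ((I.d : ℝ) + 1)) ^ (2 - ε') ≤ A := by
    calc (((I.n : ℝ) + 1) * ((I.d : ℝ) + 1)) ^ (2 - ε') ≤ (((I.n : ℝ) + 1) * ((I.d : ℝ) + 1)) ^ (2 - ε'') :=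
          Real.rpow_le_rpow_of_exponent_le hT1 he1
      _ = ((I.n : ℝ) + 1) ^ (2 - ε'') * ((I.d : ℝ) + 1) ^ (2 - ε'') := Real.mul_rpow (by linarith) (by linarith)
      _ ≤ ((I.n : ℝ) + 1) ^ (2 - ε'') * ((I.d : ℝ) + 1) ^ (2 : ℕ) := by
          refine mul_le_mul_of_nonneg_left ?_ (Real.rpow_nonneg (by linarith) _)
          rw [← Real.rpow_natCast]
          exact Real.rpow_le_rpow_of_exponent_le hd1 (by norm_num; linarith)
  have hA1 : (1 : ℝ) ≤ A := by
    have : (1 : ℝ) ≤ ((I.n : ℝ) + 1) ^ (2 - ε'') := Real.one_le_rpow hn1 (by linarith)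
    have : (1 : ℝ) ≤ ((I.d : ℝ) + 1) ^ (2 : ℕ) := by nlinarith
    rw [hA]; nlinarith
  have h2 : C * (((I.n : ℝ) + 1) * ((I.d : ℝ) + 1)) ^ (2 - ε') ≤ M * A :=
    (mul_le_mul_of_nonneg_right hC1 hpow0).trans (mul_le_mul_of_nonneg_left h1 (by linarith))
  have h3 : C ≤ M * A := hC1.trans (by nlinarith)
  linarith

/-- **Discharge of `not_lcs_inTimeO_of_sethWordRAM`** (Bringmann–Künnemann, FOCS 2015, Thm. 1.2
for LCS on binary strings; Abboud–Backurs–Vassilevska Williams, FOCS 2015, Thm. 1 for alphabet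
size 7): word-RAM SETH ⇒ OVH (`ovConjectureDet_of_sethWordRAM_holds`, Williams' split-and-list,
with `ovhWordRAM_of_sethWordRAM_of_ovConjectureDet`) ⇒ no `O(m^{2-ε})` binary LCS
(`not_lcs_inTimeO_of_ovhWordRAM`).
[cite: BringmannKunnemannFOCS2015, Thm. 1.2 (LCS)] [cite: AbboudBackursVassilevskaWilliamsFOCS2015, Thm. 1] -/
theorem not_lcs_inTimeO_of_sethWordRAM_holds : not_lcs_inTimeO_of_sethWordRAM :=
  fun hSETH ε hε => not_lcs_inTimeO_of_ovhWordRAM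
    (ovhWordRAM_of_sethWordRAM_of_ovConjectureDet ovConjectureDet_of_sethWordRAM_holds hSETH) ε hε

end Literature.Computability.FineGrained
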